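import Literature.NumberTheory.EllipticCurves.ZpExtensionEisensteinDVRSettingH4RestrictedAdjointProofs
import HarnessLib

/-!
# H.4 at the places `v ∣ p` for the curve's Eisenstein setting, IX: `he_red` and the projection formula along the two-index maps
# `F (b+1) (a+1)` / `F (a+1) (b+1)` with FREE indices `a ≤ b` (the `hAdj0` / `hAdj′` inputs of (EXACT-REP))

`Proofs` file (theorems only; no definition, no named fact, no instance, no `sorry`).  Sequel of
`ZpExtensionEisensteinDVRSettingH4TransferFormProofs` and `…H4RestrictedAdjointProofs` (the `(k, d)`-indexed forms).

For the curve's tower `W.eisensteinTower κ hm`, ANY H.4 data `D k` over `A_{m,k+1}` with the reduction identity `he_red`, ANY value map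
`ι : A_{m,a+1} → A_{m,b+1}` with `ι ∘ reduce = p^{b−a} ·`, and free indices `a ≤ b` (`F = eisensteinTwistTorsionTransfer`):

* §1 `eisensteinTower_reduce_e_transfer` — `reduce (e_b (x, y)) = e_a (F (b+1) (a+1) x, F (b+1) (a+1) y)` (`he_red` iterated);
  `eisensteinTower_apply_e_transfer_right` — `ι (e_a (s, F (b+1) (a+1) t)) = e_b (F (a+1) (b+1) s, t)`;
  `eisensteinTower_apply_e_transfer_left` — `ι (e_a (F (b+1) (a+1) s, t)) = e_b (s, F (a+1) (b+1) t)`;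
* §2 `eisensteinTower_localCup_transfer_adjoint'` — `H²(ι(1)) (x ∪_a H¹(Tw F (b+1) (a+1)) w) = H¹(F (a+1) (b+1)) x ∪_b w`
  (`DualityDatum.localCup_map_adjoint'`), = the `hAdj′` input of `Tower.exists_sub_pow_smul_forall_pairing_eq_zero` at
  `(a, b) := (i, k+1+i)`, and the weak form `eisensteinTower_localCup_transfer_eq_zero_of_eq_zero` (= `hAdj0` at `(k, k+1+i)`).

Cell `pub/bsd-print-x9` (STUB A `hfin4` at `v ∣ p`, (EXACT-REP-INST)).  No summit statement is proved here; BSD is not proved by any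
of this.  References: [Howard2004HeegnerKolyvagin] Def. 1.1.3, §1.3 H.4, §1.6 (arXiv:1202.6340 p. 5, p. 7 L78–82, p. 11 L33–38);
[NeukirchSchmidtWingberg2008] I §4 (1.4.2)–(1.4.6).
-/

set_option autoImplicit false

noncomputable section

open Function NumberField IsDedekindDomain Field CategoryTheory
open scoped NumberField ContRepresentation

namespace WeierstrassCurve

open Literature.NumberTheory.EllipticCurves Literature.NumberTheory.GaloisRepresentations
open Literature.NumberTheory.GaloisRepresentations.DiscreteGaloisModule
open Literature.NumberTheory.GaloisCohomology Literature.NumberTheory.GaloisCohomology.Howard2004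
open Literature.NumberTheory.EllipticCurves.ZpExtension (EisensteinLevel)

variable {K : Type} [Field K] [NumberField K] (W : WeierstrassCurve ℚ) [W.IsElliptic] {p : ℕ} [hp : Fact p.Prime]
  (κ : ZpExtension K p) {m : ℕ} (hm : 1 ≤ m) (cd : ConjugationDatum K)
  (D : letI := IwasawaAlgebra.isLocalRing_quotient_X_pow_add_C p hm
    ∀ k, DualityDatum p cd ((W.eisensteinTower κ hm).ρ k) (IwasawaAlgebra.EisensteinCoeff p m (k + 1)))
  (he_red : letI := IwasawaAlgebra.isLocalRing_quotient_X_pow_add_C p hm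
    ∀ k (x y : EisensteinLevel p m (fun j ↦ geomTorsion (W.baseChange K) ((p : ℤ) ^ j)) (k + 1 + 1)),
      IwasawaAlgebra.EisensteinCoeff.reduce p m (Nat.le_succ (k + 1)) ((D (k + 1)).e x y) =
        (D k).e ((W.eisensteinTower κ hm).red k x) ((W.eisensteinTower κ hm).red k y))

/-! ## §1 `he_red` and the `e`-clauses along the two-index maps, free indices -/

include he_red in
/-- **`reduce (e_b (x, y)) = e_a (F (b+1) (a+1) x, F (b+1) (a+1) y)`** for `a ≤ b` (`he_red` iterated; `red^{(d)} = F`).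
[cite: Howard2004HeegnerKolyvagin, §1.6 (arXiv p. 11, L33–38)] -/
theorem eisensteinTower_reduce_e_transfer {a b : ℕ} (hab : a ≤ b)
    (x y : EisensteinLevel p m (fun j ↦ geomTorsion (W.baseChange K) ((p : ℤ) ^ j)) (b + 1)) :
    letI := IwasawaAlgebra.isLocalRing_quotient_X_pow_add_C p hm
    IwasawaAlgebra.EisensteinCoeff.reduce p m (Nat.succ_le_succ hab) ((D b).e x y) =
      (D a).e
        ((W.baseChange K).eisensteinTwistTorsionTransfer κ hm (fun j ↦ (W.baseChange K).torsionGaloisModuleReduce p j)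
          (W.torsionGaloisModuleReduce_coe (K := K) (p := p)) (b + 1) (a + 1)
          (x : IwasawaAlgebra.EisensteinCoeff.Twisted p m (b + 1) (geomTorsion (W.baseChange K) ((p : ℤ) ^ (b + 1)))))
        ((W.baseChange K).eisensteinTwistTorsionTransfer κ hm (fun j ↦ (W.baseChange K).torsionGaloisModuleReduce p j)
          (W.torsionGaloisModuleReduce_coe (K := K) (p := p)) (b + 1) (a + 1)
          (y : IwasawaAlgebra.EisensteinCoeff.Twisted p m (b + 1) (geomTorsion (W.baseChange K) ((p : ℤ) ^ (b + 1))))) := by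
  letI := IwasawaAlgebra.isLocalRing_quotient_X_pow_add_C p hm
  obtain ⟨d, rfl⟩ := Nat.exists_eq_add_of_le hab
  rw [← W.eisensteinTower_redIter_eq_eisensteinTwistTorsionTransfer κ hm a d x,
    ← W.eisensteinTower_redIter_eq_eisensteinTwistTorsionTransfer κ hm a d y]
  exact W.reduce_e_redIter κ hm cd D he_red a d x y

include he_red in
/-- **`ι (e_a (s, F (b+1) (a+1) t)) = e_b (F (a+1) (b+1) s, t)`** for `a ≤ b` and any value map `ι` with `ι ∘ reduce = p^{b−a} ·`.
[cite: Howard2004HeegnerKolyvagin, §1.6 (arXiv p. 11, L33–38) and Def. 1.1.3] -/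
theorem eisensteinTower_apply_e_transfer_right {a b : ℕ} (hab : a ≤ b)
    (ι : IwasawaAlgebra.EisensteinCoeff p m (a + 1) →+ IwasawaAlgebra.EisensteinCoeff p m (b + 1))
    (hι : ∀ x : IwasawaAlgebra.EisensteinCoeff p m (b + 1),
      ι (IwasawaAlgebra.EisensteinCoeff.reduce p m (Nat.succ_le_succ hab) x) = p ^ (b - a) • x)
    (s : EisensteinLevel p m (fun j ↦ geomTorsion (W.baseChange K) ((p : ℤ) ^ j)) (a + 1))
    (t : EisensteinLevel p m (fun j ↦ geomTorsion (W.baseChange K) ((p : ℤ) ^ j)) (b + 1)) :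
    letI := IwasawaAlgebra.isLocalRing_quotient_X_pow_add_C p hm
    ι ((D a).e s
        ((W.baseChange K).eisensteinTwistTorsionTransfer κ hm (fun j ↦ (W.baseChange K).torsionGaloisModuleReduce p j)
          (W.torsionGaloisModuleReduce_coe (K := K) (p := p)) (b + 1) (a + 1)
          (t : IwasawaAlgebra.EisensteinCoeff.Twisted p m (b + 1) (geomTorsion (W.baseChange K) ((p : ℤ) ^ (b + 1)))))) =
      (D b).e
        ((W.baseChange K).eisensteinTwistTorsionTransfer κ hm (fun j ↦ (W.baseChange K).torsionGaloisModuleReduce p j)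
          (W.torsionGaloisModuleReduce_coe (K := K) (p := p)) (a + 1) (b + 1)
          (s : IwasawaAlgebra.EisensteinCoeff.Twisted p m (a + 1) (geomTorsion (W.baseChange K) ((p : ℤ) ^ (a + 1))))) t := by
  letI := IwasawaAlgebra.isLocalRing_quotient_X_pow_add_C p hm
  obtain ⟨d, rfl⟩ := Nat.exists_eq_add_of_le hab
  have hι' : ∀ x : IwasawaAlgebra.EisensteinCoeff p m (a + d + 1),
      ι (IwasawaAlgebra.EisensteinCoeff.reduce p m (Nat.succ_le_succ (Nat.le_add_right a d)) x) = p ^ d • x := fun x ↦ by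
    rw [hι, Nat.add_sub_cancel_left]
  rw [← W.eisensteinTower_redIter_eq_eisensteinTwistTorsionTransfer κ hm a d t]
  exact W.eisensteinTower_apply_e_transfer_redIter κ hm cd D he_red a d ι hι' s t

include he_red in
/-- **`ι (e_a (F (b+1) (a+1) s, t)) = e_b (s, F (a+1) (b+1) t)`** (mirror clause).
[cite: Howard2004HeegnerKolyvagin, §1.6 (arXiv p. 11, L33–38) and Def. 1.1.3] -/
theorem eisensteinTower_apply_e_transfer_left {a b : ℕ} (hab : a ≤ b)
    (ι : IwasawaAlgebra.EisensteinCoeff p m (a + 1) →+ IwasawaAlgebra.EisensteinCoeff p m (b + 1))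
    (hι : ∀ x : IwasawaAlgebra.EisensteinCoeff p m (b + 1),
      ι (IwasawaAlgebra.EisensteinCoeff.reduce p m (Nat.succ_le_succ hab) x) = p ^ (b - a) • x)
    (s : EisensteinLevel p m (fun j ↦ geomTorsion (W.baseChange K) ((p : ℤ) ^ j)) (b + 1))
    (t : EisensteinLevel p m (fun j ↦ geomTorsion (W.baseChange K) ((p : ℤ) ^ j)) (a + 1)) :
    letI := IwasawaAlgebra.isLocalRing_quotient_X_pow_add_C p hm
    ι ((D a).e
        ((W.baseChange K).eisensteinTwistTorsionTransfer κ hm (fun j ↦ (W.baseChange K).torsionGaloisModuleReduce p j)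
          (W.torsionGaloisModuleReduce_coe (K := K) (p := p)) (b + 1) (a + 1)
          (s : IwasawaAlgebra.EisensteinCoeff.Twisted p m (b + 1) (geomTorsion (W.baseChange K) ((p : ℤ) ^ (b + 1))))) t) =
      (D b).e s
        ((W.baseChange K).eisensteinTwistTorsionTransfer κ hm (fun j ↦ (W.baseChange K).torsionGaloisModuleReduce p j)
          (W.torsionGaloisModuleReduce_coe (K := K) (p := p)) (a + 1) (b + 1)
          (t : IwasawaAlgebra.EisensteinCoeff.Twisted p m (a + 1) (geomTorsion (W.baseChange K) ((p : ℤ) ^ (a + 1))))) := by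
  letI := IwasawaAlgebra.isLocalRing_quotient_X_pow_add_C p hm
  obtain ⟨d, rfl⟩ := Nat.exists_eq_add_of_le hab
  have hι' : ∀ x : IwasawaAlgebra.EisensteinCoeff p m (a + d + 1),
      ι (IwasawaAlgebra.EisensteinCoeff.reduce p m (Nat.succ_le_succ (Nat.le_add_right a d)) x) = p ^ d • x := fun x ↦ by
    rw [hι, Nat.add_sub_cancel_left]
  rw [← W.eisensteinTower_redIter_eq_eisensteinTwistTorsionTransfer κ hm a d s]
  exact W.eisensteinTower_apply_e_redIter_transfer κ hm cd D he_red a d ι hι' s t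

/-! ## §2 The projection formula along the two-index maps, free indices -/

include he_red in
/-- **(Adj′) along `F`, free indices**: `H²(ι(1)) (x ∪_a H¹(Tw F (b+1) (a+1)) w) = H¹(F (a+1) (b+1)) x ∪_b w` for `a ≤ b`, any value map `ι`
with `ι ∘ reduce = p^{b−a} ·`, any place `v` — the `hAdj′` input of `Tower.exists_sub_pow_smul_forall_pairing_eq_zero`.
[cite: Howard2004HeegnerKolyvagin, §1.3 H.4 (arXiv p. 7, L78–82), §1.6 (p. 11 L33–38)] [cite: NeukirchSchmidtWingberg2008, I §4 (1.4.2)–(1.4.6)] -/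
theorem eisensteinTower_localCup_transfer_adjoint' {a b : ℕ} (hab : a ≤ b) (v : Place K)
    (ι : IwasawaAlgebra.EisensteinCoeff p m (a + 1) →+ IwasawaAlgebra.EisensteinCoeff p m (b + 1))
    (hι : ∀ x : IwasawaAlgebra.EisensteinCoeff p m (b + 1),
      ι (IwasawaAlgebra.EisensteinCoeff.reduce p m (Nat.succ_le_succ hab) x) = p ^ (b - a) • x)
    (x : letI := IwasawaAlgebra.isLocalRing_quotient_X_pow_add_C p hm
      galoisCohomology (((W.eisensteinTower κ hm).ρ a).toLocal v) 1)
    (w : letI := IwasawaAlgebra.isLocalRing_quotient_X_pow_add_C p hm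
      galoisCohomology ((cd.twist ((W.eisensteinTower κ hm).ρ b)).toLocal v) 1) :
    letI := IwasawaAlgebra.isLocalRing_quotient_X_pow_add_C p hm
    ContinuousRep.cohomologyMap ((D a).twistOne.toLocal v) ((D b).twistOne.toLocal v) ι continuous_of_discreteTopology
        (fun _ z => (D a).twistOne_apply_of_apply_reduce (D b) _ ι (p ^ (b - a)) hι _ z) 2
        ((D a).localCup v x
          (galoisCohomology.map (DiscreteGaloisModule.localMap (DiscreteGaloisModule.restrictMap
            ((W.baseChange K).eisensteinTwistTorsionTransfer κ hm (fun j ↦ (W.baseChange K).torsionGaloisModuleReduce p j)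
              (W.torsionGaloisModuleReduce_coe (K := K) (p := p)) (b + 1) (a + 1)) cd.conj) v) 1 w)) =
      (D b).localCup v
        (galoisCohomology.map (DiscreteGaloisModule.localMap
          ((W.baseChange K).eisensteinTwistTorsionTransfer κ hm (fun j ↦ (W.baseChange K).torsionGaloisModuleReduce p j)
            (W.torsionGaloisModuleReduce_coe (K := K) (p := p)) (a + 1) (b + 1)) v) 1 x) w := by
  letI := IwasawaAlgebra.isLocalRing_quotient_X_pow_add_C p hm
  let F := (W.baseChange K).eisensteinTwistTorsionTransfer κ hm
    (fun j ↦ (W.baseChange K).torsionGaloisModuleReduce p j) (W.torsionGaloisModuleReduce_coe (K := K) (p := p))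
  exact (D a).localCup_map_adjoint' (D b) ((F (a + 1) (b + 1)).toContinuousLinearMap.toLinearMap.toAddMonoidHom)
    (fun g z => congrArg (fun φ ↦ φ z) ((F (a + 1) (b + 1)).isIntertwining' g))
    ((F (b + 1) (a + 1)).toContinuousLinearMap.toLinearMap.toAddMonoidHom)
    (fun g z => congrArg (fun φ ↦ φ z) ((F (b + 1) (a + 1)).isIntertwining' g)) ι
    (fun g z => (D a).twistOne_apply_of_apply_reduce (D b) _ ι (p ^ (b - a)) hι g z)
    (fun s t => W.eisensteinTower_apply_e_transfer_right κ hm cd D he_red hab ι hι s t) v x w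

include he_red in
/-- **(Adj′) along `F`, weak form**: `x ∪_a H¹(Tw F (b+1) (a+1)) w = 0 → H¹(F (a+1) (b+1)) x ∪_b w = 0` — the `hAdj0` input of
`Tower.exists_sub_pow_smul_forall_pairing_eq_zero` (value maps exist: `EisensteinCoeff.exists_addMonoidHom_apply_reduce_eq_pow_smul`).
[cite: Howard2004HeegnerKolyvagin, §1.3 H.4 (arXiv p. 7, L78–82), §1.6 (p. 11 L33–38)] [cite: NeukirchSchmidtWingberg2008, I §4 (1.4.2)] -/
theorem eisensteinTower_localCup_transfer_eq_zero_of_eq_zero {a b : ℕ} (hab : a ≤ b) (v : Place K)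
    (x : letI := IwasawaAlgebra.isLocalRing_quotient_X_pow_add_C p hm
      galoisCohomology (((W.eisensteinTower κ hm).ρ a).toLocal v) 1)
    (w : letI := IwasawaAlgebra.isLocalRing_quotient_X_pow_add_C p hm
      galoisCohomology ((cd.twist ((W.eisensteinTower κ hm).ρ b)).toLocal v) 1)
    (h0 : letI := IwasawaAlgebra.isLocalRing_quotient_X_pow_add_C p hm
      (D a).localCup v x
          (galoisCohomology.map (DiscreteGaloisModule.localMap (DiscreteGaloisModule.restrictMap
            ((W.baseChange K).eisensteinTwistTorsionTransfer κ hm (fun j ↦ (W.baseChange K).torsionGaloisModuleReduce p j)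
              (W.torsionGaloisModuleReduce_coe (K := K) (p := p)) (b + 1) (a + 1)) cd.conj) v) 1 w) = 0) :
    letI := IwasawaAlgebra.isLocalRing_quotient_X_pow_add_C p hm
    (D b).localCup v
        (galoisCohomology.map (DiscreteGaloisModule.localMap
          ((W.baseChange K).eisensteinTwistTorsionTransfer κ hm (fun j ↦ (W.baseChange K).torsionGaloisModuleReduce p j)
            (W.torsionGaloisModuleReduce_coe (K := K) (p := p)) (a + 1) (b + 1)) v) 1 x) w = 0 := by
  letI := IwasawaAlgebra.isLocalRing_quotient_X_pow_add_C p hm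
  obtain ⟨ι, hι⟩ := IwasawaAlgebra.EisensteinCoeff.exists_addMonoidHom_apply_reduce_eq_pow_smul (p := p) m
    (Nat.succ_le_succ hab)
  have hι' : ∀ y : IwasawaAlgebra.EisensteinCoeff p m (b + 1),
      ι (IwasawaAlgebra.EisensteinCoeff.reduce p m (Nat.succ_le_succ hab) y) = p ^ (b - a) • y := fun y ↦ by
    rw [hι, Nat.succ_sub_succ]
  rw [← W.eisensteinTower_localCup_transfer_adjoint' κ hm cd D he_red hab v ι hι' x w, h0]
  exact map_zero _

end WeierstrassCurve

end
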